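import Literature.NumberTheory.EllipticCurves.TakahashiDegreeFormulaCoprimeProofs
import Literature.NumberTheory.EllipticCurves.MultiplicativeComponentGroupOrder
import HarnessLib

/-!
# `stub_takahashi` (crux stmt-ABC-11338 `DefiniteXi.DefiniteRTControlPrime`) — ideator k1, gen 18
# FAMILY 1 (recognise & import): the printed idiom `c_r = #Φ_r(E)` at COPRIME level, bridged

Companion of `STUB-IDEAS-stub_takahashi-1.md` (gen 18).  The stub
`theorem stub_takahashi : takahashi2001_thm_2_3_of_coprime` is a reviewed NAMED FACT (Takahashi
2001 Thm 2.3 at `r ∥ N`, cofactor `M` arbitrary); gens 2–17 typed its standard two-leaf split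
`H_R` (Brandt multiplicity one) + `H_D` (character-group dictionary) ⟹ stub (k1-g15, rc 0).
New here (gen 18):

* `H_C` `componentGroupOrder_eq_factorization_minimalDiscriminantNorm_of_coprime` — the COPRIME
  twin of the tree's square-free-only `componentGroupOrder_eq_factorization_minimalDiscriminantNorm`:
  for `N(W) = M r`, `gcd(M, r) = 1`, the Kodaira component-group order at `v_r` is
  `(W.minimalDiscriminantNorm ℤ).factorization r ≥ 1` (Takahashi p. 75 "`c_r = ord_r(Δ)`" at the
  Frey levels `2^e · M'`, where the tree lemma does not apply).  PROVED below.
* `H_C'` the same for `Fintype.card D.Φ`, `D : NeronComponentData W v_r`.  PROVED.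
* `H_D'` `characterGroupDictionary_of_coprime_kodaira` — `H_D` with the monodromy value on `X_r(E)`
  written AS PRINTED, `u_E(a,b) = #Φ_r(E) · a · b` (Conrad–Stein 2001 Thm 6.1/Cor 6.6 speak of
  component-group orders), i.e. with `(W.kodairaSymbolAt v_r).componentGroupOrder`; and the bridge
  `characterGroupDictionary_of_coprime_of_kodaira : H_D' → H_D` (PROVED, by `H_C`).
* `A'` `takahashi2001_thm_2_3_of_coprime_of_kodaira_leaves : H_R → H_D' → stub` (PROVED).

Nothing here asserts `H_R`, `H_D`, `H_D'`.
-/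

set_option linter.dupNamespace false

noncomputable section

namespace Summit.ABC.ABC.Cruxes.DefiniteRTControlPrime.StubIdeas1G18

open scoped BigOperators
open IsDedekindDomain
open Literature.NumberTheory.EllipticCurves Literature.NumberTheory.EllipticCurves.ModularForms
open Literature.NumberTheory.Automorphic Literature.NumberTheory.DiophantineGeometry

/-- The place of `ℤ` at a prime `r`. -/
abbrev placeAt {r : ℕ} (hr : r.Prime) : HeightOneSpectrum ℤ :=
  (Rat.HeightOneSpectrum.primesEquiv (R := ℤ)).symm ⟨r, hr⟩

/-- `H_C` — **`#Φ_r(E) = ord_r Δ_min(E) ≥ 1` at a prime dividing the conductor exactly once**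
(coprime twin of `componentGroupOrder_eq_factorization_minimalDiscriminantNorm`): if `N(W) = M r`
with `r` prime and `gcd(M, r) = 1`, then `f_r = 1`, the Kodaira symbol at `v_r` is `Iₙ` with
`n = ord_r Δ_min = (W.minimalDiscriminantNorm ℤ).factorization r ≥ 1`. [cite: Takahashi2001, §1 p. 75]
[cite: SilvermanATAEC1994, IV Table 4.1 and Cor. IV.9.2] -/
theorem componentGroupOrder_eq_factorization_minimalDiscriminantNorm_of_coprime
    (W : WeierstrassCurve ℚ) [W.IsElliptic] {M r : ℕ} [NeZero (M * r)] (hr : r.Prime)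
    (hMr : M.Coprime r) (hN : W.conductorNorm ℤ = M * r) :
    (W.kodairaSymbolAt (placeAt hr)).componentGroupOrder =
        (W.minimalDiscriminantNorm ℤ).factorization r ∧
      0 < (W.minimalDiscriminantNorm ℤ).factorization r := by
  have hgen : Rat.HeightOneSpectrum.natGenerator (placeAt hr) = r :=
    natGenerator_primesEquiv_symm hr
  have hM : M ≠ 0 := fun h0 => NeZero.ne (M * r) (by rw [h0, Nat.zero_mul])
  have hrM : ¬ r ∣ M := (Nat.Prime.coprime_iff_not_dvd hr).mp hMr.symm
  have h1 : W.conductorExponent (placeAt hr) = 1 := by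
    have hf := W.factorization_conductorNorm_holds (placeAt hr)
    rw [hgen, hN] at hf
    rw [← hf, Nat.factorization_mul hM hr.ne_zero, Finsupp.add_apply,
      Nat.factorization_eq_zero_of_not_dvd hrM, hr.factorization_self]
  have hΔ := W.factorization_minimalDiscriminantNorm_holds (placeAt hr)
  rw [hgen] at hΔ
  rw [hΔ, componentGroupOrder_kodairaSymbolAt_eq W (placeAt hr) h1]
  exact ⟨rfl, (kodairaSymbolAt_eq_I_of_conductorExponent_eq_one W (placeAt hr) h1).2⟩

/-- `H_C'` — the same for the geometric component group of any Néron component datum at `v_r`: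
`#Φ = (W.minimalDiscriminantNorm ℤ).factorization r`. [cite: Takahashi2001, §1 p. 75] -/
theorem card_neronComponent_eq_factorization_minimalDiscriminantNorm_of_coprime
    (W : WeierstrassCurve ℚ) [W.IsElliptic] {M r : ℕ} [NeZero (M * r)] (hr : r.Prime)
    (hMr : M.Coprime r) (hN : W.conductorNorm ℤ = M * r)
    (D : NeronComponentData W (placeAt hr)) :
    Fintype.card D.Φ = (W.minimalDiscriminantNorm ℤ).factorization r := by
  rw [D.card_eq, (componentGroupOrder_eq_factorization_minimalDiscriminantNorm_of_coprime W hr hMr hN).1]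

/-- `H_R` — multiplicity one for the Brandt eigen-lattice at coprime level `(M, r)` (k1-g15 verbatim;
Pizer 1980 Def. 1.2 / Thm. 2.28). Leaf; PROVED in tree only at square-free `M r`. -/
def brandtEigenLattice_rank_one_of_coprime : Prop :=
  ∀ (W : WeierstrassCurve ℚ) [W.IsElliptic] (M r : ℕ) [NeZero (M * r)],
    r.Prime → M.Coprime r → W.conductorNorm ℤ = M * r →
    ∀ (_P : ModularParametrizationData W (M * r)) (S : Brandt.XiSetup M r)
      [Fintype (Brandt.ClassSet S.O)],
      Module.finrank ℤ
        (Brandt.eigenLattice (M * r) (Brandt.matrix S.O) (fun n => W.LFunction n)) = 1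

/-- `H_D` — the character-group dictionary at `r ∥ N` in the STUB's idiom (`c_r := ord_r Δ_min`);
k1-g15 verbatim (Conrad–Stein 2001 Thm 6.1 + §7.1, `M` arbitrary; Kohel 2001 Thm 4.3 at `D = 1`). -/
def characterGroupDictionary_of_coprime : Prop :=
  ∀ (W : WeierstrassCurve ℚ) [W.IsElliptic] (M r : ℕ) [NeZero (M * r)],
    r.Prime → M.Coprime r → W.conductorNorm ℤ = M * r →
    ∀ P : ModularParametrizationData W (M * r),
      (∀ (W' : WeierstrassCurve ℚ) [W'.IsElliptic], W'.conductorNorm ℤ = M * r →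
          ∀ P' : ModularParametrizationData W' (M * r),
          P'.f = P.f → P.modularDegree ≤ P'.modularDegree) →
      ∀ (S : Brandt.XiSetup M r) [Fintype (Brandt.ClassSet S.O)],
        ∃ (X : Submodule ℤ (Brandt.ClassSet S.O → ℤ)) (pb : ℤ →ₗ[ℤ] X) (pf : X →ₗ[ℤ] ℤ),
          (∀ (a : ℤ) (y : X),
              ∑ i, (Brandt.weight S.O i : ℤ) * (pb a : Brandt.ClassSet S.O → ℤ) i *
                  (y : Brandt.ClassSet S.O → ℤ) i =
                ((W.minimalDiscriminantNorm ℤ).factorization r : ℤ) * a * pf y) ∧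
          (∀ a : ℤ, pf (pb a) = (P.modularDegree : ℤ) * a) ∧
          Function.Surjective pf ∧
          (∀ (m : ℤ) (v : Brandt.ClassSet S.O → ℤ), m ≠ 0 → m • v ∈ X → v ∈ X) ∧
          (pb 1 : Brandt.ClassSet S.O → ℤ) ∈
            Brandt.eigenLattice (M * r) (Brandt.matrix S.O) (fun n => W.LFunction n)

/-- `H_D'` — the same dictionary with the monodromy value on `X_r(E) = ℤ` AS PRINTED:
`u_E(a, b) = #Φ_r(E) · a · b`, `#Φ_r(E)` the order of the component group of the Néron fibre at `r`
(tree idiom: `(W.kodairaSymbolAt v_r).componentGroupOrder`; Grothendieck SGA 7 IX 11.5 = Takahashi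
Prop. 1.1; Conrad–Stein 2001 Thm 6.1 / Cor 6.6 are statements about `#Φ`). [cite: Takahashi2001, Prop. 1.1, §2 p. 78]
[cite: ConradStein2001, Thm. 6.1, Cor. 6.6, §7.1] -/
def characterGroupDictionary_of_coprime_kodaira : Prop :=
  ∀ (W : WeierstrassCurve ℚ) [W.IsElliptic] (M r : ℕ) [NeZero (M * r)] (hr : r.Prime),
    M.Coprime r → W.conductorNorm ℤ = M * r →
    ∀ P : ModularParametrizationData W (M * r),
      (∀ (W' : WeierstrassCurve ℚ) [W'.IsElliptic], W'.conductorNorm ℤ = M * r →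
          ∀ P' : ModularParametrizationData W' (M * r),
          P'.f = P.f → P.modularDegree ≤ P'.modularDegree) →
      ∀ (S : Brandt.XiSetup M r) [Fintype (Brandt.ClassSet S.O)],
        ∃ (X : Submodule ℤ (Brandt.ClassSet S.O → ℤ)) (pb : ℤ →ₗ[ℤ] X) (pf : X →ₗ[ℤ] ℤ),
          (∀ (a : ℤ) (y : X),
              ∑ i, (Brandt.weight S.O i : ℤ) * (pb a : Brandt.ClassSet S.O → ℤ) i *
                  (y : Brandt.ClassSet S.O → ℤ) i =
                ((W.kodairaSymbolAt (placeAt hr)).componentGroupOrder : ℤ) * a * pf y) ∧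
          (∀ a : ℤ, pf (pb a) = (P.modularDegree : ℤ) * a) ∧
          Function.Surjective pf ∧
          (∀ (m : ℤ) (v : Brandt.ClassSet S.O → ℤ), m ≠ 0 → m • v ∈ X → v ∈ X) ∧
          (pb 1 : Brandt.ClassSet S.O → ℤ) ∈
            Brandt.eigenLattice (M * r) (Brandt.matrix S.O) (fun n => W.LFunction n)

/-- **Bridge** `H_D' → H_D`: rewrite `#Φ_r(E)` to `ord_r Δ_min` with `H_C`. PROVED. -/
theorem characterGroupDictionary_of_coprime_of_kodaira
    (h : characterGroupDictionary_of_coprime_kodaira) : characterGroupDictionary_of_coprime := by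
  intro W _ M r _ hr hcop hN P hmin S _
  obtain ⟨X, pb, pf, hadj, hδ, hsurj, hsat, hmem⟩ := h W M r hr hcop hN P hmin S
  refine ⟨X, pb, pf, fun a y => ?_, hδ, hsurj, hsat, hmem⟩
  rw [hadj a y,
    (componentGroupOrder_eq_factorization_minimalDiscriminantNorm_of_coprime W hr hcop hN).1]

/-- `A` — the stub from the two leaves in the stub's idiom (k1-g15, via the tree's
`takahashi2001_thm_2_3_of_coprime_of_brandtDictionary_one'`). PROVED. -/
theorem takahashi2001_thm_2_3_of_coprime_holds_of (h₁ : brandtEigenLattice_rank_one_of_coprime)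
    (h₂ : characterGroupDictionary_of_coprime) : takahashi2001_thm_2_3_of_coprime := by
  refine takahashi2001_thm_2_3_of_coprime_of_brandtDictionary_one' ?_
  intro W _ M r _ hr hcop hN P hmin hne
  obtain ⟨S₀⟩ := hne
  classical
  letI : Fintype (Brandt.ClassSet S₀.O) := Fintype.ofFinite _
  obtain ⟨X, pb, pf, hadj, hδ, hsurj, hXsat, hmem⟩ := h₂ W M r hr hcop hN P hmin S₀
  exact ⟨S₀, inferInstance, X, pb, pf, hadj, hδ, hsurj, hXsat, h₁ W M r hr hcop hN P S₀, hmem⟩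

/-- `A'` — **the stub from the two leaves in the PRINTED idiom** (`#Φ_r(E)`). PROVED. -/
theorem takahashi2001_thm_2_3_of_coprime_of_kodaira_leaves
    (h₁ : brandtEigenLattice_rank_one_of_coprime)
    (h₂ : characterGroupDictionary_of_coprime_kodaira) : takahashi2001_thm_2_3_of_coprime :=
  takahashi2001_thm_2_3_of_coprime_holds_of h₁ (characterGroupDictionary_of_coprime_of_kodaira h₂)

/-- The verbatim stub shape, CONDITIONALLY on the leaves (landable only `--supports stmt-ABC-11338
--as helper`; the hypothesis-free `theorem stub_takahashi` is not in reach). -/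
theorem stub_takahashi_of_kodaira_leaves (h₁ : brandtEigenLattice_rank_one_of_coprime)
    (h₂ : characterGroupDictionary_of_coprime_kodaira) : takahashi2001_thm_2_3_of_coprime :=
  takahashi2001_thm_2_3_of_coprime_of_kodaira_leaves h₁ h₂

end Summit.ABC.ABC.Cruxes.DefiniteRTControlPrime.StubIdeas1G18

end
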